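import Summits.NavierStokesRegularity.NavierStokesRegularity.Theorems.EulerZoomLiouvillePowerGaugeEulerLiouvilleEnergySaturationMember
import Summits.NavierStokesRegularity.NavierStokesRegularity.Theorems.EulerZoomLiouvillePowerGaugeEulerLiouvilleNeedleThinness
import Literature.Analysis.FluidPDE.LeraySeparationOfEnergyTools
import Literature.Analysis.FunctionSpaces.SobolevDomainProofs

/-!
# Crux E `PowerGaugeEulerLiouville` (stmt-NavierStokesRegularity-19832) — needle log-capacity portrait, proof side I:
# THE TWO SHELL INPUTS OF A `C¹` SELF-SIMILAR PROFILE (gradient energy and velocity mass on balls)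

Route №10 `EulerZoomLiouville` (NavierStokesRegularity), crux E, THE ONE STATEMENT `stub_selfSimilarC2Needle` (skeleton of record
`Lines/birth.lean`, interim LEAD ns-typeII-p2 g10).  The NEEDLE LOG-CAPACITY PORTRAIT (LEAD g10 08:52:09Z / 09:02:38Z with nsreg-p2 g31):
a `C¹` exactly self-similar profile `V` of a class member that has a radial FAST-INFLOW core `⟪−ŷ₀, V⟫ ≥ κ‖y₀‖` along a cylinder of length `h`
at radius `‖y₀‖ ≍ L` must have the cylinder super-exponentially thin, `w ≲ κ⁻¹ L^{−1−ρ} exp(−c₁ κ² L^{1+ρ} h / c)` — the planar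
logarithmic capacity of p2 g31's plate t36 (`…NeedleLogCapacity*`) applied on transversal discs (t36c `…NeedleDiscChart`), with the energy
and the superlevel area of a good slice paid by the class gauges.  THIS FILE derives, from `EnergySaturation.profileData_of_selfSimilar`,
the two inputs the kernel theorem consumes, in the form it consumes them (lintegral bounds on a ball, classical `fderiv`):

* `lintegral_ball_fderiv_sq_le_of_weight` — for `C¹` `V` with weak gradient `G` and E-weight `∫ |G|²_F ‖y‖^{ρ−1} ≤ B`:
  `∫_{B_R} ‖∇V‖² ≤ R^{1−ρ} · B` (`G = ∇V` a.e. by uniqueness of weak derivatives; `‖·‖²_op ≤ |·|²_F`; `‖y‖^{ρ−1} ≥ R^{ρ−1}` on `B_R`);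
* `selfSimilar_shell_inputs` — member level (crux hypotheses verbatim + exact self-similarity + `ContDiff ℝ 1 V`, `0 < ρ < 1`): for every
  `R > 0`, `∫_{B_R} ‖∇V‖² ≤ (1−ρ)/(2+ρ) · c · R^{1−ρ}` and `∫_{B_R} |V|² ≤ c · R^{1−2ρ}`;
* `needleThinCore` — **THE THIN-CORE PORTRAIT** (profile level, signature typed by nsreg-p2 g31): A-growth + E-weight (op-norm form) ⇒ for
  `L ≥ L₀(c,C,κ,ρ)` every `κ`-core cylinder of height `L/2` based at distance `s₀ ∈ [L,2L]` has in-radius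
  `w ≤ 16 √(c+1) κ⁻¹ L^{−1−ρ} · exp(−κ² L^{2+ρ}/(96 C))` — p2 g31's kernel `NeedleThinness.needle_inradius_le_radial` (planar logarithmic
  capacity of a good transversal slice, plates t36/t36c/t36d) instantiated with `R = 3L`, `h = L/2`, `δ² = w² + 32𝓐/(πκ²s₀²h)`.

WHAT THIS IS NOT: not NS, not E, no stub closes — bookkeeping for a kernel PORTRAIT of the needle of THE ONE STATEMENT; 19832 OPEN.  [folklore]
-/

noncomputable section

set_option linter.dupNamespace false

open MeasureTheory Set Filter Topology Metric Function TopologicalSpace Real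
open scoped ENNReal NNReal RealInnerProductSpace

namespace Summit.NavierStokesRegularity.NavierStokesRegularity.Theorems.PowerGaugeEulerLiouville.NeedleThinCore

open Literature.Analysis Literature.Analysis.FluidPDE

/-- **Gradient energy on a ball from the E-weight.**  If `V ∈ C¹` has weak gradient `G` on `ℝ³` with
`∫ |G(y)|²_F ‖y‖^{ρ−1} dy ≤ B` and `ρ < 1`, then `∫_{B_R} ‖∇V‖² ≤ R^{1−ρ} B` for every `R > 0`. [folklore] -/
theorem lintegral_ball_fderiv_sq_le_of_weight {ρ : ℝ} (hρ1 : ρ < 1)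
    {V : EuclideanSpace ℝ (Fin 3) → EuclideanSpace ℝ (Fin 3)}
    {G : EuclideanSpace ℝ (Fin 3) → EuclideanSpace ℝ (Fin 3) →L[ℝ] EuclideanSpace ℝ (Fin 3)} (hV : ContDiff ℝ 1 V)
    (hG : Literature.Analysis.FunctionSpaces.HasWeakFDerivOn (⊤ : Opens (EuclideanSpace ℝ (Fin 3))) volume V G) {B : ℝ≥0∞}
    (hE : ∫⁻ y, ENNReal.ofReal (frobeniusNormSq (G y)) * ENNReal.ofReal (‖y‖ ^ (ρ - 1)) ≤ B) {R : ℝ} (hR : 0 < R) :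
    ∫⁻ y in ball (0 : EuclideanSpace ℝ (Fin 3)) R, ‖fderiv ℝ V y‖ₑ ^ 2 ≤ ENNReal.ofReal (R ^ (1 - ρ)) * B := by
  -- the weak gradient is the classical one, a.e.
  have hae : G =ᵐ[volume] fderiv ℝ V := by
    have h := Literature.Analysis.FunctionSpaces.HasWeakFDerivOn.unique_holds hG
      (Literature.Analysis.FunctionSpaces.HasWeakFDerivOn.of_contDiff_holds ⊤ volume hV)
    rwa [Opens.coe_top, Measure.restrict_univ] at h
  have h0 : ∀ᵐ y ∂(volume : Measure (EuclideanSpace ℝ (Fin 3))), y ≠ 0 := by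
    have h : (volume : Measure (EuclideanSpace ℝ (Fin 3))) {0} = 0 := measure_singleton 0
    rw [ae_iff]
    simpa only [ne_eq, not_not, setOf_eq_eq_singleton] using h
  -- pointwise comparison on the punctured ball
  have hpt : ∀ᵐ y ∂(volume : Measure (EuclideanSpace ℝ (Fin 3))), y ∈ ball (0 : EuclideanSpace ℝ (Fin 3)) R →
      ‖fderiv ℝ V y‖ₑ ^ 2 ≤ ENNReal.ofReal (R ^ (1 - ρ)) *
        (ENNReal.ofReal (frobeniusNormSq (G y)) * ENNReal.ofReal (‖y‖ ^ (ρ - 1))) := by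
    filter_upwards [hae, h0] with y hy hy0 hyR
    rw [mem_ball, dist_zero_right] at hyR
    have hypos : 0 < ‖y‖ := norm_pos_iff.2 hy0
    have e1 : ‖fderiv ℝ V y‖ₑ ^ 2 = ENNReal.ofReal (‖fderiv ℝ V y‖ ^ 2) := by
      rw [← ofReal_norm, ENNReal.ofReal_pow (norm_nonneg _)]
    rw [e1, hy]
    have hfrob : ‖fderiv ℝ V y‖ ^ 2 ≤ frobeniusNormSq (fderiv ℝ V y) := norm_sq_le_frobeniusNormSq _
    have hfrob0 : 0 ≤ frobeniusNormSq (fderiv ℝ V y) := frobeniusNormSq_nonneg _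
    have hw : 1 ≤ R ^ (1 - ρ) * ‖y‖ ^ (ρ - 1) := by
      have h1 : R ^ (ρ - 1) ≤ ‖y‖ ^ (ρ - 1) := Real.rpow_le_rpow_of_nonpos hypos hyR.le (by linarith)
      have h2 : R ^ (1 - ρ) * R ^ (ρ - 1) = 1 := by
        rw [← Real.rpow_add hR]
        norm_num
      calc (1 : ℝ) = R ^ (1 - ρ) * R ^ (ρ - 1) := h2.symm
        _ ≤ R ^ (1 - ρ) * ‖y‖ ^ (ρ - 1) := by gcongr
    have hRpos : 0 ≤ R ^ (1 - ρ) := by positivity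
    have hypow : 0 ≤ ‖y‖ ^ (ρ - 1) := by positivity
    rw [← ENNReal.ofReal_mul hfrob0, ← ENNReal.ofReal_mul hRpos]
    refine ENNReal.ofReal_le_ofReal ?_
    calc ‖fderiv ℝ V y‖ ^ 2 ≤ 1 * frobeniusNormSq (fderiv ℝ V y) := by rw [one_mul]; exact hfrob
      _ ≤ (R ^ (1 - ρ) * ‖y‖ ^ (ρ - 1)) * frobeniusNormSq (fderiv ℝ V y) := by gcongr
      _ = R ^ (1 - ρ) * (frobeniusNormSq (fderiv ℝ V y) * ‖y‖ ^ (ρ - 1)) := by ring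
  calc ∫⁻ y in ball (0 : EuclideanSpace ℝ (Fin 3)) R, ‖fderiv ℝ V y‖ₑ ^ 2
      ≤ ∫⁻ y in ball (0 : EuclideanSpace ℝ (Fin 3)) R, ENNReal.ofReal (R ^ (1 - ρ)) *
          (ENNReal.ofReal (frobeniusNormSq (G y)) * ENNReal.ofReal (‖y‖ ^ (ρ - 1))) :=
        setLIntegral_mono_ae' measurableSet_ball hpt
    _ ≤ ∫⁻ y, ENNReal.ofReal (R ^ (1 - ρ)) * (ENNReal.ofReal (frobeniusNormSq (G y)) * ENNReal.ofReal (‖y‖ ^ (ρ - 1))) :=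
        setLIntegral_le_lintegral _ _
    _ = ENNReal.ofReal (R ^ (1 - ρ)) * ∫⁻ y, ENNReal.ofReal (frobeniusNormSq (G y)) * ENNReal.ofReal (‖y‖ ^ (ρ - 1)) :=
        lintegral_const_mul' _ _ ENNReal.ofReal_ne_top
    _ ≤ ENNReal.ofReal (R ^ (1 - ρ)) * B := by gcongr

/-- **THE TWO SHELL INPUTS OF A `C¹` EXACTLY SELF-SIMILAR PROFILE** (crux hypotheses verbatim + exact self-similarity, `0 < ρ < 1`,
`V ∈ C¹`): for every `R > 0`,
`∫_{B_R} ‖∇V‖² ≤ (1−ρ)/(2+ρ) · c · R^{1−ρ}` (E-gauge) and `∫_{B_R} |V|² ≤ c · R^{1−2ρ}` (A-gauge) — conjuncts 6–7 of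
`EnergySaturation.profileData_of_selfSimilar` with the weak gradient identified with `fderiv ℝ V`. [folklore] -/
theorem selfSimilar_shell_inputs {ρ : ℝ} (hρ : 0 < ρ) (hρ1 : ρ < 1)
    {u : ℝ → EuclideanSpace ℝ (Fin 3) → EuclideanSpace ℝ (Fin 3)} {p : ℝ → EuclideanSpace ℝ (Fin 3) → ℝ}
    {H : ℝ → EuclideanSpace ℝ (Fin 3) → EuclideanSpace ℝ (Fin 3) →L[ℝ] EuclideanSpace ℝ (Fin 3)} {c : ℝ≥0}
    (hsw : IsSuitableWeakSolutionOn (slab (EuclideanSpace ℝ (Fin 3)) (Iio 0) isOpen_Iio) 0 0 u p)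
    (hH : HasWeakSpatialGradientOn (slab (EuclideanSpace ℝ (Fin 3)) (Iio 0) isOpen_Iio) u H)
    (hgauge : ∀ a : ℝ, 0 < a →
      ENNReal.ofReal (a ^ (2 * ρ)) * cknA a (0 : ℝ × EuclideanSpace ℝ (Fin 3)) u +
          ENNReal.ofReal (a ^ ρ) * cknE a (0 : ℝ × EuclideanSpace ℝ (Fin 3)) H +
        ENNReal.ofReal (a ^ (2 * ρ)) * cknD a (0 : ℝ × EuclideanSpace ℝ (Fin 3)) p ≤ (c : ℝ≥0∞))
    {V : EuclideanSpace ℝ (Fin 3) → EuclideanSpace ℝ (Fin 3)} {P : EuclideanSpace ℝ (Fin 3) → ℝ}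
    (hu : ∀ τ : ℝ, τ < 0 → u τ = selfSimilarCollapse (1 / (2 + ρ)) 0 V τ)
    (hp : ∀ τ : ℝ, τ < 0 → p τ = selfSimilarCollapsePressure (1 / (2 + ρ)) 0 P τ)
    (hV : ContDiff ℝ 1 V) {R : ℝ} (hR : 0 < R) :
    ∫⁻ y in ball (0 : EuclideanSpace ℝ (Fin 3)) R, ‖fderiv ℝ V y‖ₑ ^ 2 ≤
        ENNReal.ofReal ((1 - ρ) / (2 + ρ) * c * R ^ (1 - ρ)) ∧
      ∫⁻ y in ball (0 : EuclideanSpace ℝ (Fin 3)) R, ‖V y‖ₑ ^ 2 ≤ ENNReal.ofReal (c * R ^ (1 - 2 * ρ)) := by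
  obtain ⟨G, -, -, -, -, hVG, hA, hE, -⟩ := EnergySaturation.profileData_of_selfSimilar hρ hρ1 hsw hH hgauge hu hp
  refine ⟨?_, ?_⟩
  · refine (lintegral_ball_fderiv_sq_le_of_weight hρ1 hV hVG hE hR).trans (le_of_eq ?_)
    rw [ENNReal.ofReal_mul (by positivity : (0 : ℝ) ≤ (1 - ρ) / (2 + ρ) * c), ENNReal.ofReal_mul (by
      have : 0 ≤ 1 - ρ := by linarith
      positivity : (0 : ℝ) ≤ (1 - ρ) / (2 + ρ)), ENNReal.ofReal_coe_nnreal]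
    ring
  · refine (hA R hR).trans (le_of_eq ?_)
    rw [ENNReal.ofReal_mul (NNReal.coe_nonneg c), ENNReal.ofReal_coe_nnreal]


/-! ### Real-variable bookkeeping for the instantiation -/

/-- **Absorbing the core radius into the disc radius.**  If `w ≤ √(w² + D²)·e^{−X}` with `w, D ≥ 0` and `e^{−2X} ≤ 1/2`, then
`w ≤ √2 · D · e^{−X}` (square, move `w² e^{−2X}` to the left). [folklore] -/
theorem radius_absorb {w D X : ℝ} (hw : 0 ≤ w) (hD : 0 ≤ D) (hX : Real.exp (-(2 * X)) ≤ 1 / 2)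
    (h : w ≤ Real.sqrt (w ^ 2 + D ^ 2) * Real.exp (-X)) : w ≤ Real.sqrt 2 * D * Real.exp (-X) := by
  have hexp : 0 < Real.exp (-X) := Real.exp_pos _
  have hsq : Real.exp (-(2 * X)) = Real.exp (-X) ^ 2 := by
    rw [sq, ← Real.exp_add]; ring_nf
  have h2 : w ^ 2 ≤ (w ^ 2 + D ^ 2) * Real.exp (-X) ^ 2 := by
    have h0 : 0 ≤ Real.sqrt (w ^ 2 + D ^ 2) * Real.exp (-X) := by positivity
    calc w ^ 2 ≤ (Real.sqrt (w ^ 2 + D ^ 2) * Real.exp (-X)) ^ 2 := pow_le_pow_left₀ hw h 2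
      _ = (w ^ 2 + D ^ 2) * Real.exp (-X) ^ 2 := by
          rw [mul_pow, Real.sq_sqrt (by positivity)]
  rw [← hsq] at h2
  -- `w² (1 − e^{−2X}) ≤ D² e^{−2X}` and `1 − e^{−2X} ≥ 1/2`
  have h3 : w ^ 2 ≤ 2 * D ^ 2 * Real.exp (-(2 * X)) := by nlinarith [Real.exp_pos (-(2 * X)), sq_nonneg w, sq_nonneg D]
  have h4 : (Real.sqrt 2 * D * Real.exp (-X)) ^ 2 = 2 * D ^ 2 * Real.exp (-(2 * X)) := by
    rw [mul_pow, mul_pow, Real.sq_sqrt (by norm_num : (0 : ℝ) ≤ 2), hsq]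
  have h5 : 0 ≤ Real.sqrt 2 * D * Real.exp (-X) := by positivity
  exact (pow_le_pow_iff_left₀ hw h5 two_ne_zero).1 (h4 ▸ h3)

/-- `e^{−2X} ≤ 1/2` as soon as `X ≥ 1/2` (since `e^{−1} < 1/2`). [folklore] -/
theorem exp_neg_two_mul_le_half {X : ℝ} (hX : 1 / 2 ≤ X) : Real.exp (-(2 * X)) ≤ 1 / 2 := by
  have h1 : Real.exp (-(2 * X)) ≤ Real.exp (-1) := Real.exp_le_exp.2 (by linarith)
  have h2 : Real.exp (-1) ≤ 1 / 2 := by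
    have := Real.exp_one_gt_d9
    rw [Real.exp_neg, inv_le_comm₀ (Real.exp_pos 1) (by norm_num)]
    linarith
  exact h1.trans h2


/-- **Gradient energy on a ball from the E-weight, operator-norm form** (no weak gradient): if
`∫ ‖∇V(y)‖² ‖y‖^{ρ−1} dy ≤ C` and `ρ < 1` then `∫_{B_R} ‖∇V‖² ≤ R^{1−ρ} C`. [folklore] -/
theorem lintegral_ball_fderiv_sq_le_of_opWeight {ρ : ℝ} (hρ1 : ρ < 1)
    {V : EuclideanSpace ℝ (Fin 3) → EuclideanSpace ℝ (Fin 3)} {C : ℝ≥0∞}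
    (hE : ∫⁻ y, ‖fderiv ℝ V y‖ₑ ^ 2 * ENNReal.ofReal (‖y‖ ^ (ρ - 1)) ≤ C) {R : ℝ} (hR : 0 < R) :
    ∫⁻ y in ball (0 : EuclideanSpace ℝ (Fin 3)) R, ‖fderiv ℝ V y‖ₑ ^ 2 ≤ ENNReal.ofReal (R ^ (1 - ρ)) * C := by
  have h0 : ∀ᵐ y ∂(volume : Measure (EuclideanSpace ℝ (Fin 3))), y ≠ 0 := by
    have h : (volume : Measure (EuclideanSpace ℝ (Fin 3))) {0} = 0 := measure_singleton 0
    rw [ae_iff]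
    simpa only [ne_eq, not_not, setOf_eq_eq_singleton] using h
  have hpt : ∀ᵐ y ∂(volume : Measure (EuclideanSpace ℝ (Fin 3))), y ∈ ball (0 : EuclideanSpace ℝ (Fin 3)) R →
      ‖fderiv ℝ V y‖ₑ ^ 2 ≤ ENNReal.ofReal (R ^ (1 - ρ)) * (‖fderiv ℝ V y‖ₑ ^ 2 * ENNReal.ofReal (‖y‖ ^ (ρ - 1))) := by
    filter_upwards [h0] with y hy0 hyR
    rw [mem_ball, dist_zero_right] at hyR
    have hypos : 0 < ‖y‖ := norm_pos_iff.2 hy0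
    have hw : 1 ≤ R ^ (1 - ρ) * ‖y‖ ^ (ρ - 1) := by
      have h1 : R ^ (ρ - 1) ≤ ‖y‖ ^ (ρ - 1) := Real.rpow_le_rpow_of_nonpos hypos hyR.le (by linarith)
      have h2 : R ^ (1 - ρ) * R ^ (ρ - 1) = 1 := by
        rw [← Real.rpow_add hR]
        norm_num
      calc (1 : ℝ) = R ^ (1 - ρ) * R ^ (ρ - 1) := h2.symm
        _ ≤ R ^ (1 - ρ) * ‖y‖ ^ (ρ - 1) := by gcongr
    have hw' : (1 : ℝ≥0∞) ≤ ENNReal.ofReal (R ^ (1 - ρ)) * ENNReal.ofReal (‖y‖ ^ (ρ - 1)) := by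
      rw [← ENNReal.ofReal_mul (by positivity), ← ENNReal.ofReal_one]
      exact ENNReal.ofReal_le_ofReal hw
    calc ‖fderiv ℝ V y‖ₑ ^ 2 = ‖fderiv ℝ V y‖ₑ ^ 2 * 1 := (mul_one _).symm
      _ ≤ ‖fderiv ℝ V y‖ₑ ^ 2 * (ENNReal.ofReal (R ^ (1 - ρ)) * ENNReal.ofReal (‖y‖ ^ (ρ - 1))) := by gcongr
      _ = ENNReal.ofReal (R ^ (1 - ρ)) * (‖fderiv ℝ V y‖ₑ ^ 2 * ENNReal.ofReal (‖y‖ ^ (ρ - 1))) := by ring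
  calc ∫⁻ y in ball (0 : EuclideanSpace ℝ (Fin 3)) R, ‖fderiv ℝ V y‖ₑ ^ 2
      ≤ ∫⁻ y in ball (0 : EuclideanSpace ℝ (Fin 3)) R, ENNReal.ofReal (R ^ (1 - ρ)) *
          (‖fderiv ℝ V y‖ₑ ^ 2 * ENNReal.ofReal (‖y‖ ^ (ρ - 1))) := setLIntegral_mono_ae' measurableSet_ball hpt
    _ ≤ ∫⁻ y, ENNReal.ofReal (R ^ (1 - ρ)) * (‖fderiv ℝ V y‖ₑ ^ 2 * ENNReal.ofReal (‖y‖ ^ (ρ - 1))) :=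
        setLIntegral_le_lintegral _ _
    _ = ENNReal.ofReal (R ^ (1 - ρ)) * ∫⁻ y, ‖fderiv ℝ V y‖ₑ ^ 2 * ENNReal.ofReal (‖y‖ ^ (ρ - 1)) :=
        lintegral_const_mul' _ _ ENNReal.ofReal_ne_top
    _ ≤ ENNReal.ofReal (R ^ (1 - ρ)) * C := by gcongr

open NeedleDiscChart in
/-- **THE NEEDLE THIN-CORE PORTRAIT (profile level; signature typed by nsreg-p2 g31, LEAD ns-typeII-p2 g10 KEY 2026-08-28 09:02Z).**
Let `V ∈ C¹(ℝ³; ℝ³)` have the A-growth `∫_{B_L} |V|² ≤ c L^{1−2ρ}` (`L > 0`) and the E-weight `∫ ‖∇V(y)‖² ‖y‖^{ρ−1} dy ≤ C`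
(`0 < ρ < 1`, `C > 0`), and let `κ > 0`.  Then for `L ≥ L₀(c, C, κ, ρ)`: for every orthonormal frame `(e, e₁, e₂)`, every base
distance `s₀ ∈ [L, 2L]` and every `w ∈ (0, L]`, if the solid cylinder of height `L/2` and radius `w` along `e` from `s₀ e` — the transversal
discs `discChart (t e) e₁ e₂ (D̄_w)`, `t ∈ (s₀, s₀ + L/2)` — lies in the `κ`-core `{y : −⟪e, V y⟫ ≥ κ s₀}`, then
`w ≤ 16 √(c+1) κ⁻¹ L^{−1−ρ} · exp(−κ² L^{2+ρ} / (96 C))`: fast-inflow needles of a class profile are SUPER-EXPONENTIALLY THIN.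
Proof: `NeedleThinness.needle_inradius_le_radial` (p2 g31's kernel: planar logarithmic capacity on a good transversal slice) with
`R = 3L`, `h = L/2`, `𝓔 = C (3L)^{1−ρ}` (`lintegral_ball_fderiv_sq_le_of_opWeight`), `𝓐 = (c+1)(3L)^{1−2ρ}`, `δ² = w² + 32𝓐/(πκ²s₀²h)`,
then `radius_absorb`.  WHAT THIS IS NOT: not NS, not E — a kernel PORTRAIT of THE ONE STATEMENT's needle; no stub closes. [folklore] -/
theorem needleThinCore {ρ : ℝ} (hρ : 0 < ρ) (hρ1 : ρ < 1) {c : ℝ≥0} {C : ℝ} (hC : 0 < C)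
    {V : EuclideanSpace ℝ (Fin 3) → EuclideanSpace ℝ (Fin 3)} (hV : ContDiff ℝ 1 V)
    (hA : ∀ L : ℝ, 0 < L → ∫⁻ y in ball (0 : EuclideanSpace ℝ (Fin 3)) L, ‖V y‖ₑ ^ 2 ≤
      (c : ℝ≥0∞) * ENNReal.ofReal (L ^ (1 - 2 * ρ)))
    (hE : ∫⁻ y, ‖fderiv ℝ V y‖ₑ ^ 2 * ENNReal.ofReal (‖y‖ ^ (ρ - 1)) ≤ ENNReal.ofReal C)
    {κ : ℝ} (hκ : 0 < κ) :
    ∃ L₀ : ℝ, 0 < L₀ ∧ ∀ L : ℝ, L₀ ≤ L →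
      ∀ e e₁ e₂ : EuclideanSpace ℝ (Fin 3), Orthonormal ℝ ![e, e₁, e₂] →
      ∀ s₀ : ℝ, L ≤ s₀ → s₀ ≤ 2 * L →
      ∀ w : ℝ, 0 < w → w ≤ L →
        (∀ t ∈ Ioo s₀ (s₀ + L / 2), ∀ z : ℂ, ‖z‖ ≤ w → κ * s₀ ≤ -⟪e, V (discChart (t • e) e₁ e₂ z)⟫) →
        w ≤ 16 * Real.sqrt ((c : ℝ) + 1) / κ * L ^ (-1 - ρ) * Real.exp (-(κ ^ 2 * L ^ (2 + ρ) / (96 * C))) := by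
  have hc1 : (0 : ℝ) < (c : ℝ) + 1 := by positivity
  -- the threshold
  set L₀ : ℝ := max 1 (max (64 * ((c : ℝ) + 1) / κ ^ 2) (48 * C / κ ^ 2)) with hL₀
  refine ⟨L₀, lt_of_lt_of_le one_pos (le_max_left _ _), ?_⟩
  intro L hL e e₁ e₂ hon s₀ hs₀L hs₀2 w hw hwL hcore
  have hL1 : 1 ≤ L := (le_max_left _ _).trans hL
  have hL0 : 0 < L := one_pos.trans_le hL1
  have hLc : 64 * ((c : ℝ) + 1) / κ ^ 2 ≤ L := ((le_max_left _ _).trans (le_max_right _ _)).trans hL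
  have hLC : 48 * C / κ ^ 2 ≤ L := ((le_max_right _ _).trans (le_max_right _ _)).trans hL
  have hs₀ : 0 < s₀ := hL0.trans_le hs₀L
  have hκ2 : 0 < κ ^ 2 := by positivity
  -- powers of `L`
  have hP : 0 < L ^ (1 - ρ) := Real.rpow_pos_of_pos hL0 _
  have hQ : 0 < L ^ (2 + ρ) := Real.rpow_pos_of_pos hL0 _
  have hN : 0 < L ^ (-1 - ρ) := Real.rpow_pos_of_pos hL0 _
  have hPQ : L ^ (1 - ρ) * L ^ (2 + ρ) = L ^ 3 := by
    rw [← Real.rpow_add hL0, show (1 - ρ) + (2 + ρ) = (3 : ℕ) by norm_num, Real.rpow_natCast]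
  have hN2 : (L ^ (-1 - ρ)) ^ 2 = L ^ (-2 - 2 * ρ) := by
    rw [← Real.rpow_natCast, ← Real.rpow_mul hL0.le]
    congr 1
    push_cast
    ring
  have hAexp : L ^ (1 - 2 * ρ) = L ^ (-2 - 2 * ρ) * L ^ 3 := by
    rw [← Real.rpow_natCast, ← Real.rpow_add hL0]
    congr 1
    push_cast
    ring
  have h3P : (3 * L) ^ (1 - ρ) ≤ 3 * L ^ (1 - ρ) := by
    rw [Real.mul_rpow (by norm_num) hL0.le]
    gcongr
    calc (3 : ℝ) ^ (1 - ρ) ≤ 3 ^ (1 : ℝ) := Real.rpow_le_rpow_of_exponent_le (by norm_num) (by linarith)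
      _ = 3 := Real.rpow_one 3
  have h3A : (3 * L) ^ (1 - 2 * ρ) ≤ 3 * L ^ (1 - 2 * ρ) := by
    rw [Real.mul_rpow (by norm_num) hL0.le]
    gcongr
    calc (3 : ℝ) ^ (1 - 2 * ρ) ≤ 3 ^ (1 : ℝ) := Real.rpow_le_rpow_of_exponent_le (by norm_num) (by linarith)
      _ = 3 := Real.rpow_one 3
  have h3P0 : 0 < (3 * L) ^ (1 - ρ) := Real.rpow_pos_of_pos (by positivity) _
  have h3A0 : 0 < (3 * L) ^ (1 - 2 * ρ) := Real.rpow_pos_of_pos (by positivity) _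
  have hLge : L ≤ L ^ (2 + ρ) := by
    calc L = L ^ (1 : ℝ) := (Real.rpow_one L).symm
      _ ≤ L ^ (2 + ρ) := Real.rpow_le_rpow_of_exponent_le hL1 (by linarith)
  have hLge4 : L ≤ L ^ (4 + 2 * ρ) := by
    calc L = L ^ (1 : ℝ) := (Real.rpow_one L).symm
      _ ≤ L ^ (4 + 2 * ρ) := Real.rpow_le_rpow_of_exponent_le hL1 (by linarith)
  -- the data of the kernel
  set h : ℝ := L / 2 with hh
  have hh0 : 0 < h := by positivity
  set 𝓔 : ℝ := C * (3 * L) ^ (1 - ρ) with h𝓔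
  have h𝓔0 : 0 < 𝓔 := by positivity
  set 𝓐 : ℝ := ((c : ℝ) + 1) * (3 * L) ^ (1 - 2 * ρ) with h𝓐
  have h𝓐0 : 0 < 𝓐 := by positivity
  set D2 : ℝ := 32 * 𝓐 / (π * κ ^ 2 * s₀ ^ 2 * h) with hD2
  have hD20 : 0 < D2 := by positivity
  set δ : ℝ := Real.sqrt (w ^ 2 + D2) with hδ
  have hδ2 : δ ^ 2 = w ^ 2 + D2 := Real.sq_sqrt (by positivity)
  have hδ0 : 0 < δ := Real.sqrt_pos.2 (by positivity)
  have hwδ : w < δ := lt_of_pow_lt_pow_left₀ 2 hδ0.le (by rw [hδ2]; linarith only [hD20])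
  -- the size of `D2`
  have hD2le : D2 ≤ 64 * ((c : ℝ) + 1) / κ ^ 2 * L ^ (-2 - 2 * ρ) := by
    have hs2 : L ^ 2 ≤ s₀ ^ 2 := pow_le_pow_left₀ hL0.le hs₀L 2
    have hL3 : L ^ 3 = L ^ 2 * L := by ring
    -- `D2 = 64 (c+1) (3L)^{1−2ρ} / (π κ² s₀² L) ≤ 64 (c+1) · 3 L^{1−2ρ} / (π κ² L³)` and `3/π < 1`
    have hπ3 : (3 : ℝ) < π := Real.pi_gt_three
    rw [hD2, h𝓐, hh, div_le_iff₀ (by positivity)]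
    rw [hAexp] at h3A
    have hnum : 32 * (((c : ℝ) + 1) * (3 * L) ^ (1 - 2 * ρ)) ≤ 32 * (((c : ℝ) + 1) * (3 * (L ^ (-2 - 2 * ρ) * L ^ 3))) := by
      gcongr
    refine hnum.trans ?_
    have hL22 : 0 < L ^ (-2 - 2 * ρ) := Real.rpow_pos_of_pos hL0 _
    rw [hL3]
    have : 32 * (((c : ℝ) + 1) * (3 * (L ^ (-2 - 2 * ρ) * (L ^ 2 * L)))) =
        (96 / π) * (((c : ℝ) + 1) / κ ^ 2 * L ^ (-2 - 2 * ρ)) * (π * κ ^ 2 * L ^ 2 * (L / 2)) * 2 := by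
      field_simp
      ring
    rw [this]
    have h96 : 96 / π ≤ (32 : ℝ) := by rw [div_le_iff₀ Real.pi_pos]; linarith only [hπ3]
    calc (96 / π) * (((c : ℝ) + 1) / κ ^ 2 * L ^ (-2 - 2 * ρ)) * (π * κ ^ 2 * L ^ 2 * (L / 2)) * 2
        ≤ 32 * (((c : ℝ) + 1) / κ ^ 2 * L ^ (-2 - 2 * ρ)) * (π * κ ^ 2 * s₀ ^ 2 * (L / 2)) * 2 := by gcongr
      _ = 64 * ((c : ℝ) + 1) / κ ^ 2 * L ^ (-2 - 2 * ρ) * (π * κ ^ 2 * s₀ ^ 2 * (L / 2)) := by ring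
  have hD2L : D2 ≤ L ^ 2 := by
    refine hD2le.trans ?_
    -- `64(c+1)/κ² ≤ L` and `L^{−2−2ρ} ≤ L ≤ …`: `64(c+1)/κ² · L^{−2−2ρ} ≤ L · L^{−2−2ρ} ≤ L²`
    have h1 : L ^ (-2 - 2 * ρ) ≤ 1 := Real.rpow_le_one_of_one_le_of_nonpos hL1 (by linarith)
    calc 64 * ((c : ℝ) + 1) / κ ^ 2 * L ^ (-2 - 2 * ρ) ≤ L * 1 := by gcongr
      _ ≤ L ^ 2 := by rw [mul_one, sq]; exact le_mul_of_one_le_right hL0.le hL1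
  -- the cylinder sits in `B(0, 3L)`
  have hR : (s₀ + h) ^ 2 + δ ^ 2 ≤ (3 * L) ^ 2 := by
    rw [hδ2, hh]
    have hw2 : w ^ 2 ≤ L ^ 2 := pow_le_pow_left₀ hw.le hwL 2
    have hsh : (s₀ + L / 2) ^ 2 ≤ (2 * L + L / 2) ^ 2 := pow_le_pow_left₀ (by positivity) (by linarith) 2
    have : (2 * L + L / 2) ^ 2 + (L ^ 2 + L ^ 2) ≤ (3 * L) ^ 2 := by nlinarith only [sq_nonneg L]
    linarith only [hsh, hw2, hD2L, this]
  -- the two ball inputs at radius `3L`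
  have h3L : 0 < 3 * L := by positivity
  have hE' : ∫⁻ y in ball (0 : EuclideanSpace ℝ (Fin 3)) (3 * L), ‖fderiv ℝ V y‖ₑ ^ 2 ≤ ENNReal.ofReal 𝓔 := by
    refine (lintegral_ball_fderiv_sq_le_of_opWeight hρ1 hE h3L).trans (le_of_eq ?_)
    rw [← ENNReal.ofReal_mul (by positivity), h𝓔, mul_comm]
  have hA' : ∫⁻ y in ball (0 : EuclideanSpace ℝ (Fin 3)) (3 * L), ‖V y‖ₑ ^ 2 ≤ ENNReal.ofReal 𝓐 := by
    refine (hA (3 * L) h3L).trans ?_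
    rw [← ENNReal.ofReal_coe_nnreal, ← ENNReal.ofReal_mul (NNReal.coe_nonneg c), h𝓐]
    exact ENNReal.ofReal_le_ofReal (mul_le_mul_of_nonneg_right (by linarith only []) h3A0.le)
  -- the budget (equality by the choice of `δ`)
  have hbudget : 32 * 𝓐 / (κ ^ 2 * s₀ ^ 2 * h) ≤ π * (δ ^ 2 - w ^ 2) := by
    rw [hδ2, show w ^ 2 + D2 - w ^ 2 = D2 by ring, hD2]
    refine le_of_eq ?_
    field_simp
  -- THE KERNEL
  have hker := NeedleThinness.needle_inradius_le_radial (fun y => (hV.differentiable one_ne_zero y).hasFDerivAt)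
    (hV.continuous_fderiv one_ne_zero) hon hs₀ hh0 hw hwδ hκ h3L hR h𝓔0 h𝓐0 hE' hA' hbudget hcore
  -- the exponent: `X ≥ X₁ := κ² L^{2+ρ}/(96 C)`
  set X : ℝ := π * (κ * s₀) ^ 2 * h / (16 * 𝓔) with hX
  set X₁ : ℝ := κ ^ 2 * L ^ (2 + ρ) / (96 * C) with hX₁
  have hXX : X₁ ≤ X := by
    rw [hX, hX₁, h𝓔, hh, div_le_div_iff₀ (by positivity) (by positivity)]
    -- `κ² Q · 16 C (3L)^{1−ρ} ≤ π κ² s₀² (L/2) · 96 C`, using `(3L)^{1−ρ} ≤ 3P`, `P Q = L³ ≤ s₀² L`, `3 < π`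
    have hs2 : L ^ 2 ≤ s₀ ^ 2 := pow_le_pow_left₀ hL0.le hs₀L 2
    have hπ3 : (3 : ℝ) < π := Real.pi_gt_three
    calc κ ^ 2 * L ^ (2 + ρ) * (16 * (C * (3 * L) ^ (1 - ρ)))
        ≤ κ ^ 2 * L ^ (2 + ρ) * (16 * (C * (3 * L ^ (1 - ρ)))) := by gcongr
      _ = 48 * κ ^ 2 * C * (L ^ (1 - ρ) * L ^ (2 + ρ)) := by ring
      _ = 48 * κ ^ 2 * C * (L ^ 2 * L) := by rw [hPQ]; ring
      _ ≤ 48 * κ ^ 2 * C * (s₀ ^ 2 * L) := by gcongr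
      _ = 1 * ((κ * s₀) ^ 2 * (L / 2) * (96 * C)) := by ring
      _ ≤ π * ((κ * s₀) ^ 2 * (L / 2) * (96 * C)) :=
          mul_le_mul_of_nonneg_right (by linarith only [hπ3]) (by positivity)
      _ = π * (κ * s₀) ^ 2 * (L / 2) * (96 * C) := by ring
  have hX1half : 1 / 2 ≤ X₁ := by
    rw [hX₁, le_div_iff₀ (by positivity)]
    -- `48 C ≤ κ² L ≤ κ² L^{2+ρ}`
    have h1 : 48 * C ≤ κ ^ 2 * L := by
      have := (div_le_iff₀ hκ2).1 hLC
      linarith only [this]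
    have h2 := mul_le_mul_of_nonneg_left hLge hκ2.le
    linarith only [h1, h2]
  have hexp2 : Real.exp (-(2 * X)) ≤ 1 / 2 := exp_neg_two_mul_le_half (hX1half.trans hXX)
  -- absorb the core radius
  have habs : w ≤ Real.sqrt 2 * Real.sqrt D2 * Real.exp (-X) := by
    have h1 : w ≤ Real.sqrt (w ^ 2 + Real.sqrt D2 ^ 2) * Real.exp (-X) := by
      rw [Real.sq_sqrt hD20.le, ← hδ]
      exact hker
    exact radius_absorb hw.le (Real.sqrt_nonneg _) hexp2 h1
  -- `√2 · √D2 ≤ 16 √(c+1) κ⁻¹ L^{−1−ρ}` and `e^{−X} ≤ e^{−X₁}`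
  have hsqrtD : Real.sqrt D2 ≤ 8 * Real.sqrt ((c : ℝ) + 1) / κ * L ^ (-1 - ρ) := by
    have h0 : 0 ≤ 8 * Real.sqrt ((c : ℝ) + 1) / κ * L ^ (-1 - ρ) := by positivity
    rw [← Real.sqrt_sq h0]
    refine Real.sqrt_le_sqrt (hD2le.trans (le_of_eq ?_))
    rw [mul_pow, div_pow, mul_pow, Real.sq_sqrt hc1.le, hN2]
    ring
  have hexpX : Real.exp (-X) ≤ Real.exp (-X₁) := Real.exp_le_exp.2 (by linarith)
  have hsqrt2 : Real.sqrt 2 ≤ 2 := by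
    rw [show (2 : ℝ) = Real.sqrt 4 by rw [show (4 : ℝ) = 2 ^ 2 by norm_num, Real.sqrt_sq (by norm_num)]]
    exact Real.sqrt_le_sqrt (by norm_num)
  calc w ≤ Real.sqrt 2 * Real.sqrt D2 * Real.exp (-X) := habs
    _ ≤ 2 * (8 * Real.sqrt ((c : ℝ) + 1) / κ * L ^ (-1 - ρ)) * Real.exp (-X₁) := by
        gcongr
    _ = 16 * Real.sqrt ((c : ℝ) + 1) / κ * L ^ (-1 - ρ) * Real.exp (-(κ ^ 2 * L ^ (2 + ρ) / (96 * C))) := by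
        rw [hX₁]; ring

end Summit.NavierStokesRegularity.NavierStokesRegularity.Theorems.PowerGaugeEulerLiouville.NeedleThinCore

end
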